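import Literature.Computability.Cryptography.PolyTimeComputableRealsElementary
import Literature.Computability.Cryptography.PolyTimeComputableRealsSqrt
import Literature.Computability.Complexity.MachinPiFP
import Literature.Computability.Complexity.CodeFPOfUnary
import Mathlib.Analysis.Complex.ExponentialBounds
import Mathlib.Analysis.SpecialFunctions.Trigonometric.Bounds
import Mathlib.Analysis.SpecialFunctions.Trigonometric.ArctanDeriv
import Mathlib.Analysis.Calculus.MeanValue
import Mathlib.Data.Complex.BigOperators
import HarnessLib

/-!
# Elementary transcendental functions preserve polynomial-time computability of reals — proofs

Sibling proof file of `PolyTimeComputableRealsElementary.lean`, which records as a named fact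
`Weihrauch2000_thm7318` (D-0014) the number-level corollary of K. Weihrauch, *Computable Analysis*
(Springer 2000), **Theorem 7.3.18** [Bre76]: if `x : ℝ` is a polynomial-time computable real
(`IsPolyTimeComputableReal x`, Ko 1991 Def. 2.1: a dyadic `f n / 2ⁿ` within `2⁻ⁿ`, computable from `1ⁿ`
in polynomial time; `QuantumTuringMachine.lean`) then so are `exp x`, `sin x`, `cos x`, `arctan x`.
This file proves it: **`Weihrauch2000_thm7318_holds : Weihrauch2000_thm7318`**.

## Source and route

Weihrauch prints Theorem 7.3.18 (book p. 229) as a citation of R. P. Brent, *Fast multiple-precision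
evaluation of elementary functions*, J. ACM 23 (1976) [Brent1976], in a list of "interesting results"
without proof; Brent's paper is about the fast bound `t_m(k) · log k` (AGM / Newton methods). The
vendored statement asserts only *polynomial* time at the level of numbers, for which the textbook route
suffices and is the one formalized here (Ko 1991, §2.1–2.2: evaluate a Taylor polynomial with rational
arithmetic at a dyadic approximation of the argument, control the Lipschitz and truncation errors,
round; the same pattern as `Complexity/MachinPiFP.lean` for `π`). Concretely, for a name `f` of `y`
with `|y| ≤ 1/2`:

* `ElementaryFP.of_ratScheme` — the generic step: a rational scheme `T (q, n)` computed on codes in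
  polynomial time (`CodeFP`, `Complexity/CodeFP*.lean`) with `|z − T (f(n+c)/2^{n+c}, n)| ≤ 2^{-(n+2)}`
  yields the name `n ↦ round (2^{n+2} T(…))` of `z` (`IsPolyTimeComputableReal.of_approx`);
* the schemes: `taylorSum c q K = Σ_{k<K} c k · qᵏ/k!` (`exp`: `c = 1`; `cos`/`sin`: `c = Re/Im iᵏ`,
  `cosCoeff`/`sinCoeff`) and the Gregory sum `arctanSum q K = Σ_{k<K} (−1)ᵏ q^{2k+1}/(2k+1)`, typed
  polynomial time by the `CodeFP` combinators (`ratSum` of a bounded `map`; powers `intPow`/`natPow`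
  and the new `natFactorial`, all with unary exponents);
* truncation on `[−1, 1]`: `2/K!` for `exp` (Mathlib `Real.exp_bound`), for `cos`, `sin` (real and
  imaginary parts of Mathlib `Complex.exp_bound` at `x i`), `|x|^{2K+1}` for `arctan`
  (`MachinPi.abs_arctan_sub_sum_le`, oddness); Lipschitz: `|exp a − exp b| ≤ 6|a − b|` near `0`,
  `sin`, `cos`, `arctan` are `1`-Lipschitz;
* range reduction by a constant (`x` is fixed, `|x| ≤ 2^B`, `y = x/2^{B+1}`): `exp x = (exp y)^{2^{B+1}}`
  (`.pow`), `B + 1` double-angle steps for `sin`/`cos` (`.mul`, `.sub`), and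
  `arctan x = 4 arctan (h (h x))`, `h u = u/(1 + √(1+u²))`, `|h (h x)| ≤ 1/2` (Mathlib `Real.arctan_add`;
  `.div`, `.sqrt` from `PolyTimeComputableRealsSqrt.lean`).

Everything here is proved; no definition is a stub; no named fact is introduced.

## References

* K. Weihrauch, *Computable Analysis*, Springer 2000, Thm. 7.3.18 (p. 229), Def. 7.2.6, Cor. 7.2.13,
  Example 7.2.14 [Weihrauch2000].
* R. P. Brent, *Fast multiple-precision evaluation of elementary functions*, J. ACM 23 (1976) 242–251
  [Brent1976].
* K.-I. Ko, *Complexity Theory of Real Functions*, Birkhäuser 1991, §2.1–2.2 [Ko1991].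
* J. M. Borwein, P. B. Borwein, *Pi and the AGM*, Wiley 1987, §11.1 (Gregory series) [BorweinBorwein1987].
* D. E. Knuth, *The Art of Computer Programming*, Vol. 2, 3rd ed., 1998, §4.3.1, §4.5.1 [KnuthTAOCP2].
-/

noncomputable section

namespace Literature.Computability.Cryptography

open _root_.Computability Literature.Computability.Complexity Finset
open Literature.Algebra.EuclideanLattices (encodeRat)

namespace ElementaryFP

open CodeFP Polynomial

/-! ### Factorials on codes -/

/-- The factorial fold: `k` rounds of `(i, i!) ↦ (i + 1, (i + 1)!)`. [folklore] -/
theorem foldl_factStep : ∀ (l : List Unit) (i : ℕ),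
    l.foldl (fun (b : ℕ × ℕ) (_ : Unit) => (b.1 + 1, b.2 * (b.1 + 1))) (i, i.factorial) =
      (i + l.length, (i + l.length).factorial)
  | [], i => by simp
  | _ :: l, i => by
    rw [List.foldl_cons, List.length_cons]
    have h : i.factorial * (i + 1) = (i + 1).factorial := by rw [Nat.factorial_succ, mul_comm]
    show List.foldl _ (i + 1, i.factorial * (i + 1)) l = _
    rw [h, foldl_factStep l (i + 1), show i + 1 + l.length = i + (l.length + 1) by omega]

/-- **`1ᵏ ↦ k!` is polynomial time** (a fold of `k` multiplications; `|bin k!| ≤ k |bin k| + 1`).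
A private copy of `QuantumComplexity.natFactorial_codeFP` (`QuantumComplexity/HidingPostMachine.lean`),
whose import cone (the Aaronson–Arkhipov hiding machine) does not belong below this foundational file.
[cite: KnuthTAOCP2, §4.3.1] -/
private theorem natFactorial : CodeFP unE natE Nat.factorial := by
  have hsucc : CodeFP (pairE unitE (pairE natE natE)) natE (fun t => t.2.1 + 1) :=
    (natAdd.comp ((snd _ _).fst'.pair (const _ 1)) :)
  have hstep : CodeFP (pairE unitE (pairE natE natE)) (pairE natE natE)
      (fun t => (t.2.1 + 1, t.2.2 * (t.2.1 + 1))) :=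
    hsucc.pair (natMul.comp ((snd _ _).snd'.pair hsucc))
  have h := foldl₀ (eα := unitE) (eβ := pairE natE natE)
    (step := fun (_ : Unit) (b : ℕ × ℕ) => (b.1 + 1, b.2 * (b.1 + 1))) (b₀ := ((0 : ℕ), (1 : ℕ)))
    hstep (X * X + 2 * X + 3) (fun l₁ l₂ => by
      have hf : l₁.foldl (fun (b : ℕ × ℕ) (_ : Unit) => (b.1 + 1, b.2 * (b.1 + 1))) (0, 1) =
          (l₁.length, l₁.length.factorial) := by
        have := foldl_factStep l₁ 0
        rwa [Nat.zero_add, Nat.factorial_zero] at this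
      rw [hf]
      simp only [pairE_apply, length_boolPair, eval_add, eval_mul, eval_X, eval_ofNat]
      set L := (rawE unitE (l₁ ++ l₂)).length with hL
      set m := l₁.length with hm
      have h1 : m ≤ L := le_trans (by simp [hm]) (length_le_length_rawE unitE (l₁ ++ l₂))
      have ha : (natE m).length ≤ m := length_natE_le m
      have hb : (natE m.factorial).length ≤ m * (natE m).length + 1 := by
        rw [length_natE, length_natE]
        exact (size_mono (Nat.factorial_le_pow m)).trans (size_pow_le m m)
      have hb' : (natE m.factorial).length ≤ L * L + 1 :=
        hb.trans (Nat.add_le_add_right (Nat.mul_le_mul h1 (ha.trans h1)) 1)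
      omega)
  refine ((h.comp replicateUnit).snd'.congr fun k => ?_)
  have := foldl_factStep (List.replicate k ()) 0
  rw [Nat.zero_add, Nat.factorial_zero, List.length_replicate] at this
  simp only [this]

/-! ### From a rational approximation scheme to a polynomial-time name -/

/-- The dyadic rational `a / 2ᵐ`. [folklore] -/
def dyadic (a : ℤ) (m : ℕ) : ℚ := (a : ℚ) / ((2 ^ m : ℕ) : ℚ)

/-- `a / 2ᵐ` cast to `ℝ`. [folklore] -/
theorem cast_dyadic (a : ℤ) (m : ℕ) : ((dyadic a m : ℚ) : ℝ) = (a : ℝ) / 2 ^ m := by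
  unfold dyadic; push_cast; rfl

/-- **A rational approximation scheme evaluated at a name is a name.** If `f` is a polynomial-time
name of some real, `T : ℚ × ℕ → ℚ` is computed on codes in polynomial time (rational argument, unary
precision), and `T (f (n+c)/2^{n+c}, n)` is within `2^{-(n+2)}` of `z`, then `z` is a polynomial-time
computable real: the name is `n ↦ round (2^{n+2} · T (f (n+c)/2^{n+c}, n))`, within `2^{-(n+1)}` at
scale `2^{-(n+2)}`, and the rounding lemma `IsPolyTimeComputableReal.of_approx` finishes.
[cite: Ko1991, §2.1] -/
theorem of_ratScheme {z : ℝ} {f : ℕ → ℤ}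
    (hf : PolyTimeComputable unaryEncodeNat encodingIntBool.encode f) (c : ℕ) {T : ℚ × ℕ → ℚ}
    (hT : CodeFP (pairE encodeRat unE) encodeRat T)
    (happrox : ∀ n, |z - (T (dyadic (f (n + c)) (n + c), n) : ℝ)| ≤ (1 / 2 : ℝ) ^ (n + 2)) :
    IsPolyTimeComputableReal z := by
  refine IsPolyTimeComputableReal.of_approx
    (fun n => round ((((2 ^ (n + 2) : ℕ) : ℤ) : ℚ) / ((1 : ℕ) : ℚ) * T (dyadic (f (n + c)) (n + c), n)))
    ?_ fun n => ?_
  · -- polynomial time, assembled in the `CodeFP` algebra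
    have hfC : CodeFP unE smE f := CodeFP.ofPolyTimeComputable_unE hf
    have hsh : CodeFP unE unE (fun n => n + c) := (unAdd.comp ((CodeFP.id unE).pair (const unE c)) :)
    have hsh2 : CodeFP unE unE (fun n => n + 2) := (unAdd.comp ((CodeFP.id unE).pair (const unE 2)) :)
    have hq : CodeFP unE encodeRat (fun n => dyadic (f (n + c)) (n + c)) :=
      (ratOfIntNat.comp ((intOfSM.comp (hfC.comp hsh)).pair (natPow.comp ((const unE 2).pair hsh))) :)
    have hTq : CodeFP unE encodeRat (fun n => T (dyadic (f (n + c)) (n + c), n)) :=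
      (hT.comp (hq.pair (CodeFP.id unE)) :)
    have h2p : CodeFP unE encodeRat (fun n => (((2 ^ (n + 2) : ℕ) : ℤ) : ℚ) / ((1 : ℕ) : ℚ)) :=
      (ratOfIntNat.comp ((intOfNat.comp (natPow.comp ((const unE 2).pair hsh2))).pair (const unE 1)) :)
    have hg : CodeFP unE smE (fun n => round ((((2 ^ (n + 2) : ℕ) : ℤ) : ℚ) / ((1 : ℕ) : ℚ) *
        T (dyadic (f (n + c)) (n + c), n))) :=
      (smOfInt.comp (ratRound.comp (ratMul.comp (h2p.pair hTq))) :)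
    exact hg.polyTimeComputable
  · -- the error: `2^{-(n+2)}` from the scheme plus `(1/2)/2^{n+2}` from rounding
    have h2 : (0 : ℝ) < (2 : ℝ) ^ (n + 2) := by positivity
    set t : ℚ := T (dyadic (f (n + c)) (n + c), n) with ht
    have hs : ((((2 ^ (n + 2) : ℕ) : ℤ) : ℚ) / ((1 : ℕ) : ℚ) * t : ℚ) = (2 : ℚ) ^ (n + 2) * t := by
      push_cast; ring
    rw [hs]
    have hround : |((2 : ℚ) ^ (n + 2) * t : ℚ) - (round ((2 : ℚ) ^ (n + 2) * t) : ℚ)| ≤ 1 / 2 :=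
      abs_sub_round _
    have hroundR : |(2 : ℝ) ^ (n + 2) * (t : ℝ) - ((round ((2 : ℚ) ^ (n + 2) * t) : ℤ) : ℝ)| ≤ 1 / 2 := by
      have := (Rat.cast_le (K := ℝ)).2 hround
      push_cast at this
      exact this
    have e : z - ((round ((2 : ℚ) ^ (n + 2) * t) : ℤ) : ℝ) / (2 : ℝ) ^ (n + 2) =
        (z - (t : ℝ)) + ((2 : ℝ) ^ (n + 2) * (t : ℝ) - ((round ((2 : ℚ) ^ (n + 2) * t) : ℤ) : ℝ)) /
          (2 : ℝ) ^ (n + 2) := by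
      field_simp; ring
    rw [e]
    have hdiv : (1 / 2 : ℝ) / (2 : ℝ) ^ (n + 2) ≤ (1 / 2 : ℝ) ^ (n + 2) := by
      rw [div_div, one_div_pow]
      exact one_div_le_one_div_of_le h2 (by linarith)
    calc _ ≤ |z - (t : ℝ)| + |((2 : ℝ) ^ (n + 2) * (t : ℝ) - ((round ((2 : ℚ) ^ (n + 2) * t) : ℤ) : ℝ)) /
          (2 : ℝ) ^ (n + 2)| := abs_add_le _ _
      _ ≤ (1 / 2 : ℝ) ^ (n + 2) + (1 / 2) / (2 : ℝ) ^ (n + 2) := by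
          gcongr
          · exact happrox n
          · rw [abs_div, abs_of_pos h2]
            gcongr
      _ ≤ (1 / 2 : ℝ) ^ (n + 2) + (1 / 2 : ℝ) ^ (n + 2) := by gcongr
      _ = (1 / 2 : ℝ) ^ (n + 1) := by rw [pow_succ _ (n + 1)]; ring


/-! ### Taylor polynomials in exact rational arithmetic -/

/-- The `k`-th Taylor term `c k · qᵏ / k!` as an exact fraction of integers. [folklore] -/
def taylorTerm (c : ℕ → ℤ) (q : ℚ) (k : ℕ) : ℚ :=
  ((c k * q.num ^ k : ℤ) : ℚ) / ((q.den ^ k * k.factorial : ℕ) : ℚ)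

/-- The same term with the exponent capped at a unary budget `B` (no cap takes effect when `k ≤ B`;
the cap makes the exponent a unary quantity for `CodeFP.intPow` / `CodeFP.natPow`). [folklore] -/
def taylorTermCapped (c : ℕ → ℤ) (q : ℚ) (B k : ℕ) : ℚ :=
  ((c k * q.num ^ (min k B) : ℤ) : ℚ) / ((q.den ^ (min k B) * (min k B).factorial : ℕ) : ℚ)

/-- **The Taylor polynomial `Σ_{k<K} c k · qᵏ / k!`**, an exact rational. [folklore] -/
def taylorSum (c : ℕ → ℤ) (q : ℚ) (K : ℕ) : ℚ := ((List.range K).map (taylorTerm c q)).sum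

/-- `taylorTerm c q k = c k · qᵏ / k!` in `ℚ`. [folklore] -/
theorem taylorTerm_eq (c : ℕ → ℤ) (q : ℚ) (k : ℕ) :
    taylorTerm c q k = (c k : ℚ) * q ^ k / (k.factorial : ℚ) := by
  unfold taylorTerm
  have hd : (q.den : ℚ) ≠ 0 := Nat.cast_ne_zero.2 q.den_nz
  conv_rhs => rw [← Rat.num_div_den q]
  rw [div_pow]
  push_cast
  field_simp

/-- The Taylor polynomial cast to `ℝ` is the real Taylor polynomial at `↑q`. [folklore] -/
theorem cast_taylorSum (c : ℕ → ℤ) (q : ℚ) (K : ℕ) :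
    ((taylorSum c q K : ℚ) : ℝ) = ∑ k ∈ range K, (c k : ℝ) * (q : ℝ) ^ k / (k.factorial : ℝ) := by
  unfold taylorSum
  induction K with
  | zero => simp
  | succ K ih =>
    rw [List.range_succ, List.map_append, List.sum_append, List.map_singleton, List.sum_singleton,
      Rat.cast_add, ih, sum_range_succ, taylorTerm_eq]
    push_cast
    ring

/-- **The capped Taylor term is polynomial time** in `((q, 1ᴮ), bin k)`, for a coefficient sequence
computed on codes. [cite: KnuthTAOCP2, §4.3.1] -/
theorem codeFP_taylorTermCapped {c : ℕ → ℤ} (hc : CodeFP natE intE c) :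
    CodeFP (pairE (pairE encodeRat unE) natE) encodeRat (fun p => taylorTermCapped c p.1.1 p.1.2 p.2) := by
  have hk : CodeFP (pairE (pairE encodeRat unE) natE) natE (fun p => p.2) := snd _ _
  have hB : CodeFP (pairE (pairE encodeRat unE) natE) unE (fun p => p.1.2) := (fst _ _).snd'
  have hnd : CodeFP (pairE (pairE encodeRat unE) natE) (pairE intE natE)
      (fun p => (p.1.1.num, p.1.1.den)) := (ratNumDen.comp (fst _ _).fst' :)
  have he : CodeFP (pairE (pairE encodeRat unE) natE) unE (fun p => min p.2 p.1.2) :=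
    (unOfNatMin.comp (hB.pair hk) :)
  have hnum : CodeFP (pairE (pairE encodeRat unE) natE) intE
      (fun p => c p.2 * p.1.1.num ^ (min p.2 p.1.2)) :=
    (intMul.comp ((hc.comp hk).pair (intPow.comp (hnd.fst'.pair he))) :)
  have hden : CodeFP (pairE (pairE encodeRat unE) natE) natE
      (fun p => p.1.1.den ^ (min p.2 p.1.2) * (min p.2 p.1.2).factorial) :=
    (natMul.comp ((natPow.comp (hnd.snd'.pair he)).pair (natFactorial.comp he)) :)
  exact (ratOfIntNat.comp (hnum.pair hden)).congr fun _ => rfl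

/-- **`(q, 1ᴷ) ↦ taylorSum c q K` is polynomial time** (a bounded `map` of the terms over
`[0, K)`, then the exact sum `CodeFP.ratSum`). [cite: KnuthTAOCP2, §4.3.1] -/
theorem codeFP_taylorSum {c : ℕ → ℤ} (hc : CodeFP natE intE c) :
    CodeFP (pairE encodeRat unE) encodeRat (fun p => taylorSum c p.1 p.2) := by
  have hmap := (CodeFP.map (codeFP_taylorTermCapped hc)).comp
    ((CodeFP.id (pairE encodeRat unE)).pair (urange.comp (snd encodeRat unE)))
  refine ((ratSum.comp hmap).congr fun p => ?_)
  show ((List.range p.2).map (fun k => taylorTermCapped c p.1 p.2 k)).sum = taylorSum c p.1 p.2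
  unfold taylorSum
  congr 1
  refine List.map_congr_left fun k hk => ?_
  rw [List.mem_range] at hk
  unfold taylorTermCapped taylorTerm
  rw [min_eq_left hk.le]

/-! ### The coefficient patterns of `cos` and `sin` -/

/-- `Re iᵏ`: `1, 0, −1, 0, …`. [folklore] -/
def cosCoeff (k : ℕ) : ℤ := if decide (k % 4 = 0) then 1 else if decide (k % 4 = 2) then -1 else 0

/-- `Im iᵏ`: `0, 1, 0, −1, …`. [folklore] -/
def sinCoeff (k : ℕ) : ℤ := if decide (k % 4 = 1) then 1 else if decide (k % 4 = 3) then -1 else 0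

/-- `k ↦ [k ≡ r (mod 4)]` on codes. [folklore] -/
theorem codeFP_modFourEq (r : ℕ) : CodeFP natE bitE (fun k => decide (k % 4 = r)) :=
  (natEq.comp ((natMod.comp ((CodeFP.id natE).pair (const _ 4))).pair (const _ r)) :)

/-- `cosCoeff` on codes. [folklore] -/
theorem codeFP_cosCoeff : CodeFP natE intE cosCoeff :=
  ((codeFP_modFourEq 0).ite (const _ (1 : ℤ)) ((codeFP_modFourEq 2).ite (const _ (-1 : ℤ)) (const _ (0 : ℤ)))).congr
    fun _ => rfl

/-- `sinCoeff` on codes. [folklore] -/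
theorem codeFP_sinCoeff : CodeFP natE intE sinCoeff :=
  ((codeFP_modFourEq 1).ite (const _ (1 : ℤ)) ((codeFP_modFourEq 3).ite (const _ (-1 : ℤ)) (const _ (0 : ℤ)))).congr
    fun _ => rfl

/-- `iᵏ = cosCoeff k + i · sinCoeff k`. [folklore] -/
theorem I_pow_re_im (m : ℕ) :
    (Complex.I ^ m).re = ((cosCoeff m : ℤ) : ℝ) ∧ (Complex.I ^ m).im = ((sinCoeff m : ℤ) : ℝ) := by
  rw [Complex.I_pow_eq_pow_mod]
  unfold cosCoeff sinCoeff
  have h4 : m % 4 < 4 := Nat.mod_lt _ (by norm_num)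
  generalize m % 4 = r at h4 ⊢
  interval_cases r <;> simp [pow_succ]

/-- The real part of the Taylor polynomial of `exp (x i)` is the `cos` polynomial. [folklore] -/
theorem re_expTaylor (x : ℝ) (K : ℕ) :
    (∑ m ∈ range K, ((x : ℂ) * Complex.I) ^ m / (m.factorial : ℂ)).re =
      ∑ m ∈ range K, (cosCoeff m : ℝ) * x ^ m / (m.factorial : ℝ) := by
  rw [Complex.re_sum]
  refine sum_congr rfl fun m _ => ?_
  rw [mul_pow, ← Complex.ofReal_pow, Complex.div_natCast_re, Complex.re_ofReal_mul, (I_pow_re_im m).1]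
  ring

/-- The imaginary part of the Taylor polynomial of `exp (x i)` is the `sin` polynomial. [folklore] -/
theorem im_expTaylor (x : ℝ) (K : ℕ) :
    (∑ m ∈ range K, ((x : ℂ) * Complex.I) ^ m / (m.factorial : ℂ)).im =
      ∑ m ∈ range K, (sinCoeff m : ℝ) * x ^ m / (m.factorial : ℝ) := by
  rw [Complex.im_sum]
  refine sum_congr rfl fun m _ => ?_
  rw [mul_pow, ← Complex.ofReal_pow, Complex.div_natCast_im, Complex.im_ofReal_mul, (I_pow_re_im m).2]
  ring

/-! ### Truncation errors of the Taylor polynomials on `[-1, 1]` -/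

/-- The common tail factor: `aᴷ (K+1)/(K!·K) ≤ 2/K!` for `0 ≤ a ≤ 1`, `K ≥ 1`. [folklore] -/
theorem tail_le {a : ℝ} (ha0 : 0 ≤ a) (ha : a ≤ 1) {K : ℕ} (hK : 0 < K) :
    a ^ K * ((K.succ : ℝ) / ((K.factorial : ℝ) * K)) ≤ 2 / K.factorial := by
  have h1 : a ^ K ≤ 1 := pow_le_one₀ ha0 ha
  have hf : (0 : ℝ) < K.factorial := by positivity
  have hKr : (1 : ℝ) ≤ K := by exact_mod_cast hK
  have hpos : (0 : ℝ) ≤ (K.succ : ℝ) / ((K.factorial : ℝ) * K) := by positivity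
  have h2 : (K.succ : ℝ) / ((K.factorial : ℝ) * K) ≤ 2 / K.factorial := by
    rw [div_le_div_iff₀ (by positivity) hf]
    have : (K.succ : ℝ) = K + 1 := by push_cast; ring
    rw [this]
    nlinarith
  calc a ^ K * ((K.succ : ℝ) / ((K.factorial : ℝ) * K)) ≤ 1 * ((K.succ : ℝ) / ((K.factorial : ℝ) * K)) :=
        mul_le_mul_of_nonneg_right h1 hpos
    _ ≤ 2 / K.factorial := by rw [one_mul]; exact h2

/-- **`|exp x − Σ_{m<K} xᵐ/m!| ≤ 2/K!`** for `|x| ≤ 1` (Mathlib's `Real.exp_bound`). [folklore] -/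
theorem abs_exp_sub_taylor_le {x : ℝ} (hx : |x| ≤ 1) {K : ℕ} (hK : 0 < K) :
    |Real.exp x - ∑ m ∈ range K, x ^ m / (m.factorial : ℝ)| ≤ 2 / K.factorial :=
  (Real.exp_bound hx hK).trans (tail_le (abs_nonneg x) hx hK)

/-- **`|cos x − Σ_{m<K} cosCoeff m · xᵐ/m!| ≤ 2/K!`** for `|x| ≤ 1` (real part of Mathlib's
`Complex.exp_bound` at `x i`). [folklore] -/
theorem abs_cos_sub_taylor_le {x : ℝ} (hx : |x| ≤ 1) {K : ℕ} (hK : 0 < K) :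
    |Real.cos x - ∑ m ∈ range K, (cosCoeff m : ℝ) * x ^ m / (m.factorial : ℝ)| ≤ 2 / K.factorial := by
  have hxI : ‖(x : ℂ) * Complex.I‖ ≤ 1 := by simpa using hx
  have hb := Complex.exp_bound hxI hK
  rw [← re_expTaylor, ← Complex.exp_ofReal_mul_I_re, ← Complex.sub_re]
  refine (Complex.abs_re_le_norm _).trans (hb.trans ?_)
  rw [← div_eq_mul_inv]
  have hn : ‖(x : ℂ) * Complex.I‖ = |x| := by simp
  rw [hn]
  exact tail_le (abs_nonneg x) hx hK

/-- **`|sin x − Σ_{m<K} sinCoeff m · xᵐ/m!| ≤ 2/K!`** for `|x| ≤ 1` (imaginary part). [folklore] -/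
theorem abs_sin_sub_taylor_le {x : ℝ} (hx : |x| ≤ 1) {K : ℕ} (hK : 0 < K) :
    |Real.sin x - ∑ m ∈ range K, (sinCoeff m : ℝ) * x ^ m / (m.factorial : ℝ)| ≤ 2 / K.factorial := by
  have hxI : ‖(x : ℂ) * Complex.I‖ ≤ 1 := by simpa using hx
  have hb := Complex.exp_bound hxI hK
  rw [← im_expTaylor, ← Complex.exp_ofReal_mul_I_im, ← Complex.sub_im]
  refine (Complex.abs_im_le_norm _).trans (hb.trans ?_)
  rw [← div_eq_mul_inv]
  have hn : ‖(x : ℂ) * Complex.I‖ = |x| := by simp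
  rw [hn]
  exact tail_le (abs_nonneg x) hx hK

/-- `2^{k+4} ≤ (k+4)!`. [folklore] -/
theorem two_pow_le_factorial : ∀ k : ℕ, 2 ^ (k + 4) ≤ (k + 4).factorial
  | 0 => by decide
  | k + 1 => by
    rw [pow_succ, show k + 1 + 4 = (k + 4) + 1 by omega, Nat.factorial_succ]
    have := two_pow_le_factorial k
    nlinarith

/-- `2/(n+5)! ≤ 2^{-(n+4)}`. [folklore] -/
theorem two_div_factorial_le (n : ℕ) : 2 / ((n + 5).factorial : ℝ) ≤ (1 / 2 : ℝ) ^ (n + 4) := by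
  have h := two_pow_le_factorial (n + 1)
  rw [show n + 1 + 4 = n + 5 by omega] at h
  have h' : (2 : ℝ) ^ (n + 5) ≤ ((n + 5).factorial : ℝ) := by exact_mod_cast h
  rw [one_div_pow, div_le_div_iff₀ (by positivity) (by positivity), one_mul]
  rw [pow_succ] at h'
  linarith

/-- **Lipschitz estimate for `exp` near the origin**: `|exp a − exp b| ≤ 6 |a − b|` for `|b| ≤ 1`,
`|a − b| ≤ 1` (`exp b ≤ e < 3`, `|exp h − 1| ≤ 2|h|`). [folklore] -/
theorem abs_exp_sub_exp_le {a b : ℝ} (hb : |b| ≤ 1) (hab : |a - b| ≤ 1) :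
    |Real.exp a - Real.exp b| ≤ 6 * |a - b| := by
  have e : Real.exp a - Real.exp b = Real.exp b * (Real.exp (a - b) - 1) := by
    rw [mul_sub, mul_one, ← Real.exp_add, show b + (a - b) = a by ring]
  rw [e, abs_mul, abs_of_pos (Real.exp_pos b)]
  have h1 : Real.exp b ≤ 3 :=
    (Real.exp_le_exp.2 (abs_le.1 hb).2).trans (Real.exp_one_lt_d9.le.trans (by norm_num))
  have h2 := Real.abs_exp_sub_one_le hab
  calc Real.exp b * |Real.exp (a - b) - 1| ≤ 3 * (2 * |a - b|) :=
        mul_le_mul h1 h2 (abs_nonneg _) (by norm_num)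
    _ = 6 * |a - b| := by ring

/-- `arctan` is `1`-Lipschitz (`arctan' = 1/(1+x²) ≤ 1`); a private copy of the folklore helper of
`NumberTheory/LFunctions/ZetaBacklundReflection.lean` (unrelated import cone). [folklore] -/
private theorem lipschitzWith_one_arctan : LipschitzWith 1 Real.arctan := by
  refine lipschitzWith_of_nnnorm_deriv_le Real.differentiable_arctan fun x => ?_
  rw [Real.deriv_arctan]
  have h1 : 0 ≤ 1 / (1 + x ^ 2) := by positivity
  have h2 : 1 / (1 + x ^ 2) ≤ 1 := by
    rw [div_le_one (by positivity)]; nlinarith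
  rw [← NNReal.coe_le_coe, coe_nnnorm, Real.norm_eq_abs, abs_of_nonneg h1]
  simpa using h2

/-- `|arctan a − arctan b| ≤ |a − b|`; a private copy of the folklore helper of
`NumberTheory/Transcendental/ZudilinSaddle.lean` (unrelated import cone). [folklore] -/
private theorem abs_arctan_sub_arctan_le (a b : ℝ) : |Real.arctan a - Real.arctan b| ≤ |a - b| := by
  have h := lipschitzWith_one_arctan.dist_le_mul a b
  simpa only [NNReal.coe_one, one_mul, Real.dist_eq] using h

/-! ### The Gregory series of `arctan` at a rational point -/

/-- The `k`-th Gregory term `(−1)ᵏ q^{2k+1}/(2k+1)` as an exact fraction. [cite: BorweinBorwein1987, §11.1] -/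
def arctanTerm (q : ℚ) (k : ℕ) : ℚ :=
  (((-1) ^ k * q.num ^ (2 * k + 1) : ℤ) : ℚ) / ((q.den ^ (2 * k + 1) * (2 * k + 1) : ℕ) : ℚ)

/-- The same with the exponent capped at a unary budget `B`. [folklore] -/
def arctanTermCapped (q : ℚ) (B k : ℕ) : ℚ :=
  (((-1) ^ k * q.num ^ (min (2 * k + 1) B) : ℤ) : ℚ) / ((q.den ^ (min (2 * k + 1) B) * (2 * k + 1) : ℕ) : ℚ)

/-- **The truncated Gregory series `Σ_{k<K} (−1)ᵏ q^{2k+1}/(2k+1)`**, an exact rational.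
[cite: BorweinBorwein1987, §11.1] -/
def arctanSum (q : ℚ) (K : ℕ) : ℚ := ((List.range K).map (arctanTerm q)).sum

/-- `arctanTerm q k` cast to `ℝ` is the signed Gregory term at `↑q`. [folklore] -/
theorem cast_arctanTerm (q : ℚ) (k : ℕ) :
    ((arctanTerm q k : ℚ) : ℝ) = (-1) ^ k * MachinPi.gregoryTerm (q : ℝ) k := by
  unfold arctanTerm MachinPi.gregoryTerm
  have hd : (q.den : ℝ) ≠ 0 := Nat.cast_ne_zero.2 q.den_nz
  have h2 : ((2 * k + 1 : ℕ) : ℝ) ≠ 0 := by positivity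
  have hq : (q : ℝ) = (q.num : ℝ) / (q.den : ℝ) := by exact_mod_cast (Rat.num_div_den q).symm
  rw [hq, div_pow]
  push_cast
  field_simp

/-- The truncated series cast to `ℝ` is the alternating partial sum. [folklore] -/
theorem cast_arctanSum (q : ℚ) (K : ℕ) :
    ((arctanSum q K : ℚ) : ℝ) = ∑ k ∈ range K, (-1) ^ k * MachinPi.gregoryTerm (q : ℝ) k := by
  unfold arctanSum
  induction K with
  | zero => simp
  | succ K ih =>
    rw [List.range_succ, List.map_append, List.sum_append, List.map_singleton, List.sum_singleton,
      Rat.cast_add, ih, sum_range_succ, cast_arctanTerm]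

/-- **Truncation error of the Gregory series on `(−1, 1)`**: `|arctan x − Σ_{k<K}| ≤ |x|^{2K+1}`
(alternating series bound `MachinPi.abs_arctan_sub_sum_le` for `x ≥ 0`, oddness for `x < 0`).
[cite: BorweinBorwein1987, §11.1] -/
theorem abs_arctan_sub_gregory_le {x : ℝ} (hx : |x| < 1) (K : ℕ) :
    |Real.arctan x - ∑ k ∈ range K, (-1) ^ k * MachinPi.gregoryTerm x k| ≤ |x| ^ (2 * K + 1) := by
  have hK1 : (1 : ℝ) ≤ ((2 * K + 1 : ℕ) : ℝ) := by exact_mod_cast (show 1 ≤ 2 * K + 1 by omega)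
  rcases le_or_gt 0 x with h0 | h0
  · have h := MachinPi.abs_arctan_sub_sum_le h0 (by rwa [abs_of_nonneg h0] at hx) K
    refine h.trans ?_
    unfold MachinPi.gregoryTerm
    rw [abs_of_nonneg h0]
    exact div_le_self (pow_nonneg h0 _) hK1
  · have hx' : -x < 1 := by rwa [abs_of_neg h0] at hx
    have h := MachinPi.abs_arctan_sub_sum_le (neg_nonneg.2 h0.le) hx' K
    have hodd : ∀ k, MachinPi.gregoryTerm (-x) k = -MachinPi.gregoryTerm x k := fun k => by
      unfold MachinPi.gregoryTerm
      rw [neg_pow, Odd.neg_one_pow ⟨k, rfl⟩]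
      ring
    have e : Real.arctan x - ∑ k ∈ range K, (-1) ^ k * MachinPi.gregoryTerm x k =
        -(Real.arctan (-x) - ∑ k ∈ range K, (-1) ^ k * MachinPi.gregoryTerm (-x) k) := by
      simp only [hodd, Real.arctan_neg, mul_neg, sum_neg_distrib]
      ring
    rw [e, abs_neg]
    refine h.trans ?_
    unfold MachinPi.gregoryTerm
    rw [abs_of_neg h0]
    exact div_le_self (pow_nonneg (neg_nonneg.2 h0.le) _) hK1


/-! ### The four functions at a polynomial-time real of absolute value `≤ 1/2` -/

/-- Bookkeeping: `|q| ≤ b + e` when `|y| ≤ b` and `|y − q| ≤ e`. [folklore] -/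
theorem abs_le_of_near {y q b e : ℝ} (hy : |y| ≤ b) (h : |y - q| ≤ e) : |q| ≤ b + e := by
  have := abs_sub_abs_le_abs_sub q y
  rw [abs_sub_comm] at this
  linarith

/-- `(1/2)^{n+c} ≤ (1/2)^c`. [folklore] -/
theorem half_pow_add_le (n c : ℕ) : (1 / 2 : ℝ) ^ (n + c) ≤ (1 / 2 : ℝ) ^ c := by
  rw [pow_add]
  exact mul_le_of_le_one_left (by positivity) (pow_le_one₀ (by norm_num) (by norm_num))

/-- Unary shift on codes: `1ⁿ ↦ 1^{n+c}`. [folklore] -/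
theorem codeFP_unShift (c : ℕ) : CodeFP unE unE (fun n => n + c) :=
  (unAdd.comp ((CodeFP.id unE).pair (const unE c)) :)

/-- **`exp y` for `|y| ≤ 1/2`**: the scheme `(q, n) ↦ Σ_{k<n+5} qᵏ/k!` at `q = f(n+5)/2^{n+5}`;
error `6 · 2^{-(n+5)}` (Lipschitz) `+ 2/(n+5)! ≤ 2^{-(n+4)}` (truncation) `≤ 2^{-(n+2)}`.
[cite: Ko1991, §2.1] -/
theorem exp_core {y : ℝ} (hy : IsPolyTimeComputableReal y) (hb : |y| ≤ 1 / 2) :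
    IsPolyTimeComputableReal (Real.exp y) := by
  obtain ⟨f, hf, hfb⟩ := hy
  refine of_ratScheme hf 5 (T := fun p => taylorSum (fun _ => 1) p.1 (p.2 + 5))
    ((codeFP_taylorSum (const natE (1 : ℤ))).comp ((fst _ _).pair ((codeFP_unShift 5).comp (snd _ _))) :)
    fun n => ?_
  show |Real.exp y - ((taylorSum (fun _ => 1) (dyadic (f (n + 5)) (n + 5)) (n + 5) : ℚ) : ℝ)| ≤ (1 / 2 : ℝ) ^ (n + 2)
  rw [cast_taylorSum]
  simp only [Int.cast_one, one_mul]
  set q : ℚ := dyadic (f (n + 5)) (n + 5) with hq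
  have hyq : |y - q| ≤ (1 / 2 : ℝ) ^ (n + 5) := by rw [hq, cast_dyadic]; exact hfb (n + 5)
  have h32 : (1 / 2 : ℝ) ^ (n + 5) ≤ 1 / 32 := (half_pow_add_le n 5).trans (by norm_num)
  have hq1 : |(q : ℝ)| ≤ 1 := (abs_le_of_near hb hyq).trans (by linarith)
  have h1 : |Real.exp y - Real.exp q| ≤ 6 * (1 / 2 : ℝ) ^ (n + 5) :=
    (abs_exp_sub_exp_le hq1 (hyq.trans (h32.trans (by norm_num)))).trans (by linarith)
  have h2 : |Real.exp q - ∑ k ∈ range (n + 5), (q : ℝ) ^ k / (k.factorial : ℝ)| ≤ (1 / 2 : ℝ) ^ (n + 4) :=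
    (abs_exp_sub_taylor_le hq1 (by omega)).trans (two_div_factorial_le n)
  have e5 : (1 / 2 : ℝ) ^ (n + 5) = (1 / 2 : ℝ) ^ (n + 2) / 8 := by ring
  have e4 : (1 / 2 : ℝ) ^ (n + 4) = (1 / 2 : ℝ) ^ (n + 2) / 4 := by ring
  calc |Real.exp y - ∑ k ∈ range (n + 5), (q : ℝ) ^ k / (k.factorial : ℝ)|
      ≤ |Real.exp y - Real.exp q| + |Real.exp q - ∑ k ∈ range (n + 5), (q : ℝ) ^ k / (k.factorial : ℝ)| :=
        abs_sub_le _ _ _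
    _ ≤ 6 * (1 / 2 : ℝ) ^ (n + 5) + (1 / 2 : ℝ) ^ (n + 4) := add_le_add h1 h2
    _ ≤ (1 / 2 : ℝ) ^ (n + 2) := by rw [e5, e4]; linarith [pow_pos (show (0 : ℝ) < 1 / 2 by norm_num) (n + 2)]

/-- **`sin y` for `|y| ≤ 1/2`**: the scheme `(q, n) ↦ Σ_{k<n+5} sinCoeff k · qᵏ/k!` at
`q = f(n+3)/2^{n+3}`; error `2^{-(n+3)}` (`sin` is `1`-Lipschitz) `+ 2^{-(n+4)}` (truncation).
[cite: Ko1991, §2.1] -/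
theorem sin_core {y : ℝ} (hy : IsPolyTimeComputableReal y) (hb : |y| ≤ 1 / 2) :
    IsPolyTimeComputableReal (Real.sin y) := by
  obtain ⟨f, hf, hfb⟩ := hy
  refine of_ratScheme hf 3 (T := fun p => taylorSum sinCoeff p.1 (p.2 + 5))
    ((codeFP_taylorSum codeFP_sinCoeff).comp ((fst _ _).pair ((codeFP_unShift 5).comp (snd _ _))) :)
    fun n => ?_
  show |Real.sin y - ((taylorSum sinCoeff (dyadic (f (n + 3)) (n + 3)) (n + 5) : ℚ) : ℝ)| ≤ (1 / 2 : ℝ) ^ (n + 2)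
  rw [cast_taylorSum]
  set q : ℚ := dyadic (f (n + 3)) (n + 3) with hq
  have hyq : |y - q| ≤ (1 / 2 : ℝ) ^ (n + 3) := by rw [hq, cast_dyadic]; exact hfb (n + 3)
  have h8 : (1 / 2 : ℝ) ^ (n + 3) ≤ 1 / 8 := (half_pow_add_le n 3).trans (by norm_num)
  have hq1 : |(q : ℝ)| ≤ 1 := (abs_le_of_near hb hyq).trans (by linarith)
  have h1 : |Real.sin y - Real.sin q| ≤ (1 / 2 : ℝ) ^ (n + 3) := (Real.abs_sin_sub_sin_le _ _).trans hyq
  have h2 : |Real.sin q - ∑ k ∈ range (n + 5), (sinCoeff k : ℝ) * (q : ℝ) ^ k / (k.factorial : ℝ)| ≤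
      (1 / 2 : ℝ) ^ (n + 4) :=
    (abs_sin_sub_taylor_le hq1 (by omega)).trans (two_div_factorial_le n)
  have e3 : (1 / 2 : ℝ) ^ (n + 3) = (1 / 2 : ℝ) ^ (n + 2) / 2 := by ring
  have e4 : (1 / 2 : ℝ) ^ (n + 4) = (1 / 2 : ℝ) ^ (n + 2) / 4 := by ring
  calc |Real.sin y - ∑ k ∈ range (n + 5), (sinCoeff k : ℝ) * (q : ℝ) ^ k / (k.factorial : ℝ)|
      ≤ |Real.sin y - Real.sin q| +
          |Real.sin q - ∑ k ∈ range (n + 5), (sinCoeff k : ℝ) * (q : ℝ) ^ k / (k.factorial : ℝ)| :=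
        abs_sub_le _ _ _
    _ ≤ (1 / 2 : ℝ) ^ (n + 3) + (1 / 2 : ℝ) ^ (n + 4) := add_le_add h1 h2
    _ ≤ (1 / 2 : ℝ) ^ (n + 2) := by rw [e3, e4]; linarith [pow_pos (show (0 : ℝ) < 1 / 2 by norm_num) (n + 2)]

/-- **`cos y` for `|y| ≤ 1/2`** (same scheme with `cosCoeff`). [cite: Ko1991, §2.1] -/
theorem cos_core {y : ℝ} (hy : IsPolyTimeComputableReal y) (hb : |y| ≤ 1 / 2) :
    IsPolyTimeComputableReal (Real.cos y) := by
  obtain ⟨f, hf, hfb⟩ := hy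
  refine of_ratScheme hf 3 (T := fun p => taylorSum cosCoeff p.1 (p.2 + 5))
    ((codeFP_taylorSum codeFP_cosCoeff).comp ((fst _ _).pair ((codeFP_unShift 5).comp (snd _ _))) :)
    fun n => ?_
  show |Real.cos y - ((taylorSum cosCoeff (dyadic (f (n + 3)) (n + 3)) (n + 5) : ℚ) : ℝ)| ≤ (1 / 2 : ℝ) ^ (n + 2)
  rw [cast_taylorSum]
  set q : ℚ := dyadic (f (n + 3)) (n + 3) with hq
  have hyq : |y - q| ≤ (1 / 2 : ℝ) ^ (n + 3) := by rw [hq, cast_dyadic]; exact hfb (n + 3)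
  have h8 : (1 / 2 : ℝ) ^ (n + 3) ≤ 1 / 8 := (half_pow_add_le n 3).trans (by norm_num)
  have hq1 : |(q : ℝ)| ≤ 1 := (abs_le_of_near hb hyq).trans (by linarith)
  have h1 : |Real.cos y - Real.cos q| ≤ (1 / 2 : ℝ) ^ (n + 3) := (Real.abs_cos_sub_cos_le _ _).trans hyq
  have h2 : |Real.cos q - ∑ k ∈ range (n + 5), (cosCoeff k : ℝ) * (q : ℝ) ^ k / (k.factorial : ℝ)| ≤
      (1 / 2 : ℝ) ^ (n + 4) :=
    (abs_cos_sub_taylor_le hq1 (by omega)).trans (two_div_factorial_le n)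
  have e3 : (1 / 2 : ℝ) ^ (n + 3) = (1 / 2 : ℝ) ^ (n + 2) / 2 := by ring
  have e4 : (1 / 2 : ℝ) ^ (n + 4) = (1 / 2 : ℝ) ^ (n + 2) / 4 := by ring
  calc |Real.cos y - ∑ k ∈ range (n + 5), (cosCoeff k : ℝ) * (q : ℝ) ^ k / (k.factorial : ℝ)|
      ≤ |Real.cos y - Real.cos q| +
          |Real.cos q - ∑ k ∈ range (n + 5), (cosCoeff k : ℝ) * (q : ℝ) ^ k / (k.factorial : ℝ)| :=
        abs_sub_le _ _ _
    _ ≤ (1 / 2 : ℝ) ^ (n + 3) + (1 / 2 : ℝ) ^ (n + 4) := add_le_add h1 h2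
    _ ≤ (1 / 2 : ℝ) ^ (n + 2) := by rw [e3, e4]; linarith [pow_pos (show (0 : ℝ) < 1 / 2 by norm_num) (n + 2)]

/-- **The capped Gregory term is polynomial time** in `((q, 1ᴮ), bin k)`. [cite: KnuthTAOCP2, §4.3.1] -/
theorem codeFP_arctanTermCapped :
    CodeFP (pairE (pairE encodeRat unE) natE) encodeRat (fun p => arctanTermCapped p.1.1 p.1.2 p.2) := by
  have hk : CodeFP (pairE (pairE encodeRat unE) natE) natE (fun p => p.2) := snd _ _
  have hB : CodeFP (pairE (pairE encodeRat unE) natE) unE (fun p => p.1.2) := (fst _ _).snd'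
  have hnd : CodeFP (pairE (pairE encodeRat unE) natE) (pairE intE natE)
      (fun p => (p.1.1.num, p.1.1.den)) := (ratNumDen.comp (fst _ _).fst' :)
  have hodd : CodeFP (pairE (pairE encodeRat unE) natE) natE (fun p => 2 * p.2 + 1) :=
    (natAdd.comp ((natMul.comp ((const _ 2).pair hk)).pair (const _ 1)) :)
  have he : CodeFP (pairE (pairE encodeRat unE) natE) unE (fun p => min (2 * p.2 + 1) p.1.2) :=
    (unOfNatMin.comp (hB.pair hodd) :)
  have hpar : CodeFP (pairE (pairE encodeRat unE) natE) bitE (fun p => decide (p.2 % 2 = 0)) :=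
    (natEq.comp ((natMod.comp (hk.pair (const _ 2))).pair (const _ 0)) :)
  have hsign : CodeFP (pairE (pairE encodeRat unE) natE) intE (fun p => ((-1 : ℤ) ^ p.2 : ℤ)) :=
    (hpar.ite (const _ (1 : ℤ)) (const _ (-1 : ℤ))).congr fun p => by rw [MachinPi.neg_one_pow_eq_ite]
  have hnum : CodeFP (pairE (pairE encodeRat unE) natE) intE
      (fun p => (-1 : ℤ) ^ p.2 * p.1.1.num ^ (min (2 * p.2 + 1) p.1.2)) :=
    (intMul.comp (hsign.pair (intPow.comp (hnd.fst'.pair he))) :)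
  have hden : CodeFP (pairE (pairE encodeRat unE) natE) natE
      (fun p => p.1.1.den ^ (min (2 * p.2 + 1) p.1.2) * (2 * p.2 + 1)) :=
    (natMul.comp ((natPow.comp (hnd.snd'.pair he)).pair hodd) :)
  exact (ratOfIntNat.comp (hnum.pair hden)).congr fun _ => rfl

/-- **`(q, 1ᴷ) ↦ arctanSum q K` is polynomial time** (budget `2K + 1`, items `[0, K)`, `CodeFP.ratSum`).
[cite: KnuthTAOCP2, §4.3.1] -/
theorem codeFP_arctanSum : CodeFP (pairE encodeRat unE) encodeRat (fun p => arctanSum p.1 p.2) := by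
  have hBud : CodeFP unE unE (fun K => 2 * K + 1) :=
    (unSucc.comp (unAdd.comp ((CodeFP.id unE).pair (CodeFP.id unE)))).congr fun K => by
      show K + K + 1 = 2 * K + 1
      ring
  have hctx : CodeFP (pairE encodeRat unE) (pairE encodeRat unE) (fun p => (p.1, 2 * p.2 + 1)) :=
    (fst _ _).pair (hBud.comp (snd _ _))
  have hmap := (CodeFP.map codeFP_arctanTermCapped).comp (hctx.pair (urange.comp (snd encodeRat unE)))
  refine ((ratSum.comp hmap).congr fun p => ?_)
  show ((List.range p.2).map (fun k => arctanTermCapped p.1 (2 * p.2 + 1) k)).sum = arctanSum p.1 p.2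
  unfold arctanSum
  congr 1
  refine List.map_congr_left fun k hk => ?_
  rw [List.mem_range] at hk
  unfold arctanTermCapped arctanTerm
  rw [min_eq_left (by omega)]

/-- **`arctan y` for `|y| ≤ 1/2`**: the scheme `(q, n) ↦ arctanSum q (n+4)` at `q = f(n+3)/2^{n+3}`
(`|q| ≤ 5/8`); error `2^{-(n+3)}` (`arctan` is `1`-Lipschitz) `+ (5/8)^{2n+9} ≤ 2^{-(n+4)}`.
[cite: Ko1991, §2.1] -/
theorem arctan_core {y : ℝ} (hy : IsPolyTimeComputableReal y) (hb : |y| ≤ 1 / 2) :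
    IsPolyTimeComputableReal (Real.arctan y) := by
  obtain ⟨f, hf, hfb⟩ := hy
  refine of_ratScheme hf 3 (T := fun p => arctanSum p.1 (p.2 + 4))
    (codeFP_arctanSum.comp ((fst _ _).pair ((codeFP_unShift 4).comp (snd _ _))) :) fun n => ?_
  show |Real.arctan y - ((arctanSum (dyadic (f (n + 3)) (n + 3)) (n + 4) : ℚ) : ℝ)| ≤ (1 / 2 : ℝ) ^ (n + 2)
  rw [cast_arctanSum]
  set q : ℚ := dyadic (f (n + 3)) (n + 3) with hq
  have hyq : |y - q| ≤ (1 / 2 : ℝ) ^ (n + 3) := by rw [hq, cast_dyadic]; exact hfb (n + 3)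
  have h8 : (1 / 2 : ℝ) ^ (n + 3) ≤ 1 / 8 := (half_pow_add_le n 3).trans (by norm_num)
  have hq58 : |(q : ℝ)| ≤ 5 / 8 := (abs_le_of_near hb hyq).trans (by linarith)
  have hq1 : |(q : ℝ)| < 1 := hq58.trans_lt (by norm_num)
  have h1 : |Real.arctan y - Real.arctan q| ≤ (1 / 2 : ℝ) ^ (n + 3) := (abs_arctan_sub_arctan_le _ _).trans hyq
  have h2 : |Real.arctan q - ∑ k ∈ range (n + 4), (-1) ^ k * MachinPi.gregoryTerm (q : ℝ) k| ≤
      (1 / 2 : ℝ) ^ (n + 4) := by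
    refine (abs_arctan_sub_gregory_le hq1 (n + 4)).trans ?_
    have hsq : |(q : ℝ)| ^ 2 ≤ 1 / 2 := (pow_le_pow_left₀ (abs_nonneg _) hq58 2).trans (by norm_num)
    calc |(q : ℝ)| ^ (2 * (n + 4) + 1) ≤ |(q : ℝ)| ^ (2 * (n + 4)) :=
          pow_le_pow_of_le_one (abs_nonneg _) hq1.le (by omega)
      _ = (|(q : ℝ)| ^ 2) ^ (n + 4) := by rw [pow_mul]
      _ ≤ (1 / 2 : ℝ) ^ (n + 4) := pow_le_pow_left₀ (by positivity) hsq _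
  have e3 : (1 / 2 : ℝ) ^ (n + 3) = (1 / 2 : ℝ) ^ (n + 2) / 2 := by ring
  have e4 : (1 / 2 : ℝ) ^ (n + 4) = (1 / 2 : ℝ) ^ (n + 2) / 4 := by ring
  calc |Real.arctan y - ∑ k ∈ range (n + 4), (-1) ^ k * MachinPi.gregoryTerm (q : ℝ) k|
      ≤ |Real.arctan y - Real.arctan q| +
          |Real.arctan q - ∑ k ∈ range (n + 4), (-1) ^ k * MachinPi.gregoryTerm (q : ℝ) k| :=
        abs_sub_le _ _ _
    _ ≤ (1 / 2 : ℝ) ^ (n + 3) + (1 / 2 : ℝ) ^ (n + 4) := add_le_add h1 h2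
    _ ≤ (1 / 2 : ℝ) ^ (n + 2) := by rw [e3, e4]; linarith [pow_pos (show (0 : ℝ) < 1 / 2 by norm_num) (n + 2)]

/-! ### Range reduction by a constant: every real is `2^{B+1} y` with `|y| ≤ 1/2` -/

/-- Scaling down by a power of two keeps polynomial-time computability and lands in `[-1/2, 1/2]`.
[cite: Ko1991, §2.2] -/
theorem scaleDown {x : ℝ} (hx : IsPolyTimeComputableReal x) {B : ℕ} (hB : |x| ≤ 2 ^ B) :
    IsPolyTimeComputableReal (x / 2 ^ (B + 1)) ∧ |x / 2 ^ (B + 1)| ≤ 1 / 2 := by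
  have h2 : (0 : ℝ) < 2 ^ (B + 1) := by positivity
  refine ⟨?_, ?_⟩
  · have h := hx.div (IsPolyTimeComputableReal.natCast (2 ^ (B + 1)))
    push_cast at h
    exact h
  · rw [abs_div, abs_of_pos h2, div_le_iff₀ h2, pow_succ]
    linarith

/-- **`exp` of a polynomial-time computable real is polynomial-time computable**:
`exp x = (exp (x/2^{B+1}))^{2^{B+1}}` with `|x| ≤ 2^B`. [cite: Weihrauch2000, Thm 7.3.18] -/
theorem exp_polyTime {x : ℝ} (hx : IsPolyTimeComputableReal x) : IsPolyTimeComputableReal (Real.exp x) := by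
  obtain ⟨B, hB⟩ := exists_abs_le_two_pow x
  obtain ⟨hyp, hyb⟩ := scaleDown hx hB
  have h2 : (2 : ℝ) ^ (B + 1) ≠ 0 := by positivity
  have hexp : Real.exp x = Real.exp (x / 2 ^ (B + 1)) ^ (2 ^ (B + 1)) := by
    rw [← Real.exp_nat_mul]
    congr 1
    push_cast
    field_simp
  rw [hexp]
  exact (exp_core hyp hyb).pow _

/-- Double angles: from `sin y`, `cos y` to `sin (2ʲ y)`, `cos (2ʲ y)`. [folklore] -/
theorem sin_cos_two_pow_mul {y : ℝ} (hs : IsPolyTimeComputableReal (Real.sin y))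
    (hc : IsPolyTimeComputableReal (Real.cos y)) :
    ∀ j : ℕ, IsPolyTimeComputableReal (Real.sin (2 ^ j * y)) ∧ IsPolyTimeComputableReal (Real.cos (2 ^ j * y))
  | 0 => by simpa using And.intro hs hc
  | j + 1 => by
    obtain ⟨hs', hc'⟩ := sin_cos_two_pow_mul hs hc j
    have e : (2 : ℝ) ^ (j + 1) * y = 2 * (2 ^ j * y) := by rw [pow_succ]; ring
    rw [e, Real.sin_two_mul, Real.cos_two_mul]
    exact ⟨((IsPolyTimeComputableReal.ofNat 2).mul hs').mul hc',
      ((IsPolyTimeComputableReal.ofNat 2).mul (hc'.pow 2)).sub isPolyTimeComputableReal_one⟩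

/-- **`sin` and `cos` of a polynomial-time computable real are polynomial-time computable**
(`x = 2^{B+1} y`, `|y| ≤ 1/2`, `B + 1` double-angle steps). [cite: Weihrauch2000, Thm 7.3.18] -/
theorem sin_cos_polyTime {x : ℝ} (hx : IsPolyTimeComputableReal x) :
    IsPolyTimeComputableReal (Real.sin x) ∧ IsPolyTimeComputableReal (Real.cos x) := by
  obtain ⟨B, hB⟩ := exists_abs_le_two_pow x
  obtain ⟨hyp, hyb⟩ := scaleDown hx hB
  have h2 : (2 : ℝ) ^ (B + 1) ≠ 0 := by positivity
  have e : x = 2 ^ (B + 1) * (x / 2 ^ (B + 1)) := by field_simp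
  have h := sin_cos_two_pow_mul (sin_core hyp hyb) (cos_core hyp hyb) (B + 1)
  rwa [← e] at h

/-- The half-argument map of `arctan`: `u ↦ u / (1 + √(1 + u²))` (`= tan (θ/2)` for `u = tan θ`).
[folklore] -/
def halfArg (u : ℝ) : ℝ := u / (1 + Real.sqrt (1 + u ^ 2))

/-- `halfArg` preserves polynomial-time computability (field operations and `√`,
`PolyTimeComputableRealsSqrt.lean`). [cite: Ko1991, §2.2] -/
theorem halfArg_polyTime {u : ℝ} (hu : IsPolyTimeComputableReal u) : IsPolyTimeComputableReal (halfArg u) :=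
  hu.div (isPolyTimeComputableReal_one.add ((isPolyTimeComputableReal_one.add (hu.pow 2)).sqrt))

/-- `|halfArg u| ≤ |u|/2`. [folklore] -/
theorem abs_halfArg_le (u : ℝ) : |halfArg u| ≤ |u| / 2 := by
  have hs : 1 ≤ Real.sqrt (1 + u ^ 2) := Real.one_le_sqrt.2 (by nlinarith)
  have hpos : 0 < 1 + Real.sqrt (1 + u ^ 2) := by linarith
  unfold halfArg
  rw [abs_div, abs_of_pos hpos]
  exact div_le_div_of_nonneg_left (abs_nonneg u) (by norm_num) (by linarith)

/-- `|halfArg u| < 1`. [folklore] -/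
theorem abs_halfArg_lt_one (u : ℝ) : |halfArg u| < 1 := by
  have hs : |u| ≤ Real.sqrt (1 + u ^ 2) := by
    rw [← Real.sqrt_sq_eq_abs]
    exact Real.sqrt_le_sqrt (by linarith)
  have hpos : 0 < 1 + Real.sqrt (1 + u ^ 2) := by linarith [abs_nonneg u]
  unfold halfArg
  rw [abs_div, abs_of_pos hpos, div_lt_one hpos]
  linarith

/-- **`arctan u = 2 arctan (u / (1 + √(1+u²)))`** (Mathlib's addition formula `Real.arctan_add`).
[folklore] -/
theorem arctan_eq_two_mul_arctan_halfArg (u : ℝ) : Real.arctan u = 2 * Real.arctan (halfArg u) := by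
  have h1 := abs_halfArg_lt_one u
  have hlt : halfArg u * halfArg u < 1 := by
    have h := abs_lt.1 h1
    nlinarith [abs_nonneg (halfArg u), abs_mul_abs_self (halfArg u)]
  rw [two_mul, Real.arctan_add hlt]
  congr 1
  have hne : 1 - halfArg u * halfArg u ≠ 0 := by linarith
  rw [eq_div_iff hne]
  set s := Real.sqrt (1 + u ^ 2) with hs
  have hs0 : 0 ≤ s := Real.sqrt_nonneg _
  have hs2 : s ^ 2 = 1 + u ^ 2 := Real.sq_sqrt (by positivity)
  have hd : 1 + s ≠ 0 := by positivity
  unfold halfArg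
  rw [← hs]
  field_simp
  linear_combination u * hs2

/-- **`arctan` of a polynomial-time computable real is polynomial-time computable**:
`arctan x = 4 arctan (halfArg (halfArg x))` with `|halfArg (halfArg x)| ≤ 1/2`.
[cite: Weihrauch2000, Thm 7.3.18] -/
theorem arctan_polyTime {x : ℝ} (hx : IsPolyTimeComputableReal x) : IsPolyTimeComputableReal (Real.arctan x) := by
  have e : Real.arctan x = 4 * Real.arctan (halfArg (halfArg x)) := by
    rw [arctan_eq_two_mul_arctan_halfArg x, arctan_eq_two_mul_arctan_halfArg (halfArg x)]
    ring
  have hb : |halfArg (halfArg x)| ≤ 1 / 2 :=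
    (abs_halfArg_le _).trans (by linarith [abs_halfArg_lt_one x])
  rw [e]
  exact (IsPolyTimeComputableReal.ofNat 4).mul (arctan_core (halfArg_polyTime (halfArg_polyTime hx)) hb)

end ElementaryFP

/-- **Discharge of `Weihrauch2000_thm7318`** (Brent 1976; Weihrauch 2000, Thm. 7.3.18, number-level
corollary; Ko 1991, §2): `exp`, `sin`, `cos`, `arctan` of a polynomial-time computable real are
polynomial-time computable — Taylor / Gregory series in exact rational arithmetic (`CodeFP`), Lipschitz
and truncation bookkeeping, range reduction by a constant. [cite: Weihrauch2000, Thm 7.3.18] -/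
theorem Weihrauch2000_thm7318_holds : Weihrauch2000_thm7318 := fun _ hx =>
  ⟨ElementaryFP.exp_polyTime hx, (ElementaryFP.sin_cos_polyTime hx).1, (ElementaryFP.sin_cos_polyTime hx).2,
    ElementaryFP.arctan_polyTime hx⟩

end Literature.Computability.Cryptography

end
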